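import Mathlib
import Summits.ValiantsHypothesis.ValiantsHypothesis.Theorems.MatrixDescartes.Negative.MatrixDescartesWitness24
import Summits.ValiantsHypothesis.ValiantsHypothesis.Theorems.LacunarySymmetroidMatrixDescartesCensusM2K8G21
import Summits.ValiantsHypothesis.ValiantsHypothesis.Theorems.LacunarySymmetroidMatrixDescartesCensusM2K9T27
import Summits.ValiantsHypothesis.ValiantsHypothesis.Theorems.LacunarySymmetroidMatrixDescartesCensusM2K10I30
import Summits.ValiantsHypothesis.ValiantsHypothesis.Theorems.LacunarySymmetroidMatrixDescartesFiniteSectorDefs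

/-!
# `MatrixDescartes` — line «stamp» ported: `ν ≤ ζ` (a full-positive-rooted half-pencil is a census entry), the range
# certificates of the extremal additive 2-bases, the DIVERGENCE bookkeeping at `(2,8)`/`(2,9)` («eleven-thirds» vs
# stamp-sharpness) and the `m = 2` Lorentz dictionary `4·det = T² − X² − Y²`

HONEST FRAMING.  Port (desk pub-symmetroid R2437 (A); porter val-sym-eng-3 g3) of the PROVED part of the crux workfile
`Cruxes/MatrixDescartes/Lines/stamp.lean` (val-idea-6 g3, LINE 2, lens «assume the law fails»; val-idea-crit-1 VERDICT #23 =
PASS, instrument tier, 0 provers; director-valiant g11-R19).  The crux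
`Summit.ValiantsHypothesis.ValiantsHypothesis.Theses.LacunarySymmetroid.MatrixDescartes` (`stmt-ValiantsHypothesis-18050`) is
asymptotic in `K`; nothing here bears on it or on `VP ≠ VNP`.  Vocabulary by name from `…FiniteSectorDefs` (`pencil`,
`IsFullPosRooted`, `StampLawAt`, `FullyRealisable`, the extremal bases `dA5 … dA8b`) and `PosRootLawAt` from
`Theorems/MatrixDescartes/Negative/MatrixDescartesWitness24`.  NOT ported: the workfile's §2 (`coeff_ne_zero_of_fullPos`,
`mem_sumset_of_fullPos` — already in the tree verbatim as `…FiniteSector.coeff_ne_zero_of_fullPos` / `….mem_sumset_of_fullPos`,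
p600692) and the sorried search targets G6–G9 (`FullyRealisable 2 dA5 16`, `… dA6 20`, `… dA7a/b/c 26`, `… dA8a/b 32`) —
those are the ENGINES' targets and are never asserted here; §4 below takes them as HYPOTHESES.

* **§1 `ν(m,K) ≤ ζ(m,K)`** (`not_posRootLawAt_of_fullPos`, `not_posRootLawAt_of_fullyRealisable`, `stampLawAt_of_posRootLawAt`):
  a full-positive-rooted symmetric half-pencil of degree `n` refutes the positive-root row `n − 1`.
* **§3 range certificates** (`range_dA5 … range_dA8b`, `decide`): `[0,n] ⊆ 2·({0} ∪ A)` and `n + 1 ∉ 2·({0} ∪ A)` for the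
  seven extremal bases (`n = 16, 20, 26, 26, 26, 32, 32`) — the postage-stamp ceiling does not exclude a FULL degree-`n`
  `2×2` half-pencil there, and allows no more.
* **§4 divergence bookkeeping**: G8 ⇒ ¬«eleven-thirds» at `K = 8` (`not_elevenThirds_at_eight`); G9 ⇒ the same at `K = 9`
  (`not_elevenThirds_at_nine`); conversely `PosRootLawAt 2 8 25` ⇒ the three extremal `A₇` are NOT fully realisable
  (`elevenThirds_blocks_A7`, `stampLaw_two_eight_of_elevenThirds`); the tree's kernel floors `ζ(2,8) ≥ 21`, `ζ(2,9) ≥ 27`,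
  `ζ(2,10) ≥ 30` sit below the stamp predictions (`kernel_floors_below_stamp`, by name from the census files).
* **§5 Lorentz dictionary** (`four_mul_det_fin_two_symm`): `4·det A = (a+c)² − (a−c)² − 4b²` for symmetric `2×2` `A` over any
  commutative ring — `m = 2` is a light-cone crossing problem (crit-1's model, typed).
[folklore] throughout (Descartes bookkeeping, finite sumset checks, a ring identity).
-/

-- `Summit.ValiantsHypothesis.ValiantsHypothesis.…` repeats a component by the D-0017 layout
-- (single-conjunct summit), which the `dupNamespace` linter flags; the name is mandated.
set_option linter.dupNamespace false

noncomputable section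

namespace Summit.ValiantsHypothesis.ValiantsHypothesis.Theorems.LacunarySymmetroidMatrixDescartes.FiniteSector

open Summit.ValiantsHypothesis.ValiantsHypothesis.Theorems.MatrixDescartes.Negative (PosRootLawAt)
open scoped BigOperators Matrix
open Polynomial

/-! ## §1 `ν ≤ ζ`: a full-positive-rooted half-pencil is a census entry -/

/-- **`ν(m,K) ≤ ζ(m,K)`.**  A full-positive-rooted symmetric half-pencil of degree `n` refutes the positive-root row
`n − 1` (tree `Negative.PosRootLawAt`). [folklore] -/
theorem not_posRootLawAt_of_fullPos {m K B : ℕ} (d : Fin K → ℕ) (S : Fin K → Matrix (Fin m) (Fin m) ℝ)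
    (hS : ∀ l, (S l).IsSymm)
    (hfull : IsFullPosRooted (Matrix.det (∑ l, ((Polynomial.X : ℝ[X]) ^ d l) • (S l).map Polynomial.C)))
    (hB : B < (Matrix.det (∑ l, ((Polynomial.X : ℝ[X]) ^ d l) • (S l).map Polynomial.C)).natDegree) :
    ¬ PosRootLawAt m K B := fun h => by
  have h1 : ((Matrix.det (∑ l, ((Polynomial.X : ℝ[X]) ^ d l) • (S l).map Polynomial.C)).roots.toFinset.filter
      (fun t => 0 < t)).card ≤ B := h d S hS
  unfold IsFullPosRooted at hfull
  rw [Multiset.toFinset_filter] at hfull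
  omega

/-- The typed target refutes the row below its degree. [folklore] -/
theorem not_posRootLawAt_of_fullyRealisable {m K n B : ℕ} {d : Fin K → ℕ} (h : FullyRealisable m d n)
    (hB : B < n) : ¬ PosRootLawAt m K B := by
  obtain ⟨S, hS, hfull, hdeg⟩ := h
  have hdeg' : (Matrix.det (∑ l, ((Polynomial.X : ℝ[X]) ^ d l) • (S l).map Polynomial.C)).natDegree = n := hdeg
  exact not_posRootLawAt_of_fullPos d S hS hfull (by omega)

/-- Conversely a positive-root row caps the stamp row: `ζ(m,K) ≤ B ⇒ ν(m,K) ≤ B`. [folklore] -/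
theorem stampLawAt_of_posRootLawAt {m K B : ℕ} (h : PosRootLawAt m K B) : StampLawAt m K B := by
  intro d S hS hfull
  by_contra hlt
  exact not_posRootLawAt_of_fullPos d S hS hfull (not_le.1 hlt) h

/-! ## §3 Range certificates of the extremal additive 2-bases (`decide`): `[0,n] ⊆ 2·({0} ∪ A)` and `n + 1 ∉ 2·({0} ∪ A)`,
so a FULL degree-`n` `2×2` half-pencil on the support is NOT excluded by the postage-stamp ceiling — and degree `n` is the
most the support allows -/

/-- Range certificate for `dA5 = {0,1,3,5,7,8}`: `[0,16] ⊆ 2·dA5`, `17 ∉ 2·dA5` (`n(2,5) = 16`). [folklore] -/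
theorem range_dA5 : (∀ r ≤ 16, ∃ i j : Fin 6, dA5 i + dA5 j = r) ∧ ¬ ∃ i j : Fin 6, dA5 i + dA5 j = 17 := by
  unfold dA5; decide
/-- Range certificate for `dA6 = {0,1,3,5,7,9,10}`: `[0,20]`, not `21` (`n(2,6) = 20`). [folklore] -/
theorem range_dA6 : (∀ r ≤ 20, ∃ i j : Fin 7, dA6 i + dA6 j = r) ∧ ¬ ∃ i j : Fin 7, dA6 i + dA6 j = 21 := by
  unfold dA6; decide
/-- Range certificate for `dA7a = {0,1,3,5,7,8,17,18}`: `[0,26]`, not `27` (`n(2,7) = 26`). [folklore] -/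
theorem range_dA7a : (∀ r ≤ 26, ∃ i j : Fin 8, dA7a i + dA7a j = r) ∧ ¬ ∃ i j : Fin 8, dA7a i + dA7a j = 27 := by
  unfold dA7a; decide
/-- Range certificate for `dA7b = {0,1,3,4,9,10,12,13}`: `[0,26]`, not `27`. [folklore] -/
theorem range_dA7b : (∀ r ≤ 26, ∃ i j : Fin 8, dA7b i + dA7b j = r) ∧ ¬ ∃ i j : Fin 8, dA7b i + dA7b j = 27 := by
  unfold dA7b; decide
/-- Range certificate for `dA7c = {0,1,2,5,8,11,12,13}`: `[0,26]`, not `27`. [folklore] -/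
theorem range_dA7c : (∀ r ≤ 26, ∃ i j : Fin 8, dA7c i + dA7c j = r) ∧ ¬ ∃ i j : Fin 8, dA7c i + dA7c j = 27 := by
  unfold dA7c; decide
/-- Range certificate for `dA8a = {0,1,3,5,7,9,10,21,22}`: `[0,32]`, not `33` (`n(2,8) = 32`). [folklore] -/
theorem range_dA8a : (∀ r ≤ 32, ∃ i j : Fin 9, dA8a i + dA8a j = r) ∧ ¬ ∃ i j : Fin 9, dA8a i + dA8a j = 33 := by
  unfold dA8a; decide
/-- Range certificate for `dA8b = {0,1,2,5,8,11,14,15,16}`: `[0,32]`, not `33`. [folklore] -/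
theorem range_dA8b : (∀ r ≤ 32, ∃ i j : Fin 9, dA8b i + dA8b j = r) ∧ ¬ ∃ i j : Fin 9, dA8b i + dA8b j = 33 := by
  unfold dA8b; decide

/-! ## §4 DIVERGENCE bookkeeping: stamp-sharpness at `(2,8)` kills «eleven-thirds»; «eleven-thirds» kills realisability (G8/G9 as HYPOTHESES) -/

/-- **G8 ⇒ «eleven-thirds» is false at `K = 8`** (`⌊11·7/3⌋ = 25`): `ζ(2,8) ≥ 26`. [folklore] -/
theorem not_elevenThirds_at_eight
    (h : FullyRealisable 2 dA7a 26 ∨ FullyRealisable 2 dA7b 26 ∨ FullyRealisable 2 dA7c 26) :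
    ¬ PosRootLawAt 2 8 25 := by
  rcases h with h | h | h <;> exact not_posRootLawAt_of_fullyRealisable h (by norm_num)

/-- **G9 ⇒ «eleven-thirds» is false at `K = 9`** (`⌊88/3⌋ = 29`) — and the slope law `4(K−1) = 32` is ATTAINED,
not refuted. [folklore] -/
theorem not_elevenThirds_at_nine (h : FullyRealisable 2 dA8a 32 ∨ FullyRealisable 2 dA8b 32) :
    ¬ PosRootLawAt 2 9 29 ∧ ¬ PosRootLawAt 2 9 31 := by
  rcases h with h | h <;>
    exact ⟨not_posRootLawAt_of_fullyRealisable h (by norm_num), not_posRootLawAt_of_fullyRealisable h (by norm_num)⟩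

/-- **«Eleven-thirds at `K = 8`» ⇒ the three extremal `A₇` are NOT fully realisable by symmetric `2×2` half-pencils**
— the first located NON-REALISABILITY cell, if the linear law holds. [folklore] -/
theorem elevenThirds_blocks_A7 (h : PosRootLawAt 2 8 25) :
    ¬ FullyRealisable 2 dA7a 26 ∧ ¬ FullyRealisable 2 dA7b 26 ∧ ¬ FullyRealisable 2 dA7c 26 :=
  ⟨fun h' => not_elevenThirds_at_eight (Or.inl h') h,
   fun h' => not_elevenThirds_at_eight (Or.inr (Or.inl h')) h,
   fun h' => not_elevenThirds_at_eight (Or.inr (Or.inr h')) h⟩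

/-- More generally any row `ζ(2,8) ≤ 25` caps the stamp row: `ν(2,8) ≤ 25 < 26 = n(2,7)`. [folklore] -/
theorem stampLaw_two_eight_of_elevenThirds (h : PosRootLawAt 2 8 25) : StampLawAt 2 8 25 :=
  stampLawAt_of_posRootLawAt h

/-- What the tree already knows at the divergence cells (kernel floors, by name): `ζ(2,8) ≥ 21`, `ζ(2,9) ≥ 27`,
`ζ(2,10) ≥ 30` — all BELOW the stamp predictions `26, 32, 40`. [folklore] -/
theorem kernel_floors_below_stamp :
    ¬ PosRootLawAt 2 8 20 ∧ ¬ PosRootLawAt 2 9 26 ∧ ¬ PosRootLawAt 2 10 29 :=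
  ⟨Summit.ValiantsHypothesis.ValiantsHypothesis.Theorems.LacunarySymmetroidMatrixDescartes.Census.M2K8G21.not_posRootLawAt,
   Summit.ValiantsHypothesis.ValiantsHypothesis.Theorems.LacunarySymmetroidMatrixDescartes.Census.M2K9T27.not_posRootLawAt,
   Summit.ValiantsHypothesis.ValiantsHypothesis.Theorems.LacunarySymmetroidMatrixDescartes.Census.M2K10I30.not_posRootLawAt⟩

/-! ## §5 The Lorentz dictionary for `m = 2` (crit-1's model, typed): `4·det = (a+c)² − (a−c)² − 4b²` -/

/-- **`m = 2` is a light-cone crossing problem.**  For a symmetric `2×2` matrix over any commutative ring,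
`4·det = T² − X² − Y²` with `T = a + c`, `X = a − c`, `Y = 2b`; for the pencil, `T, X, Y` are `K`-nomials on the SAME
support `E`, so `ζ(2,K)` = the maximal number of positive parameters at which a `K`-monomial curve in `ℝ^{1,2}` meets
the light cone, and FULL realisability of an extremal basis = `n(2,K−1)` transversal crossings with every coefficient of
`T² − X² − Y²` (support `2E ⊇ [0,n]`) non-zero and alternating.  A format law linear in `K` needs a crossing bound
for rank-3 quadratic forms on the Descartes system `{u^e}` beating the Descartes count `|2E| − 1`; none is known
(the parameter count `3K − 4` — the «dimension law» — is refuted in tree at `(2,4)`: `not_dimensionLaw_two_four`). -/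
theorem four_mul_det_fin_two_symm {R : Type*} [CommRing R] (A : Matrix (Fin 2) (Fin 2) R) (hA : A.IsSymm) :
    4 * A.det = (A 0 0 + A 1 1) ^ 2 - (A 0 0 - A 1 1) ^ 2 - (2 * A 0 1) ^ 2 := by
  have h10 : A 1 0 = A 0 1 := by
    have := congrFun (congrFun hA 0) 1
    simpa [Matrix.transpose_apply] using this
  rw [Matrix.det_fin_two, h10]
  ring

end Summit.ValiantsHypothesis.ValiantsHypothesis.Theorems.LacunarySymmetroidMatrixDescartes.FiniteSector

end
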